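import Summits.PneNP.PneNP.Theorems.SzkEntropyPeaWorstToAvgStubOrbitKitSubst
import HarnessLib

/-!
# Orbit kit for `orbit-pair-rsr`, III: the typed bridge of the symbolic affine action

Helper file of the stub `stub_orbitKit` (crux `SzkEntropy.PeaWorstToAvg`, line `orbit-pair-rsr`),
sequel of `…StubOrbitKitSubst.lean`:

* `evalM_transform`, `evalM_outMap` — the (normalised) symbolic transform of the untyped presentation
  of a cubic `P : PolyMapF2 s` presents `x ↦ affOut (matT B) (vecT c) (P.eval (matT A *ᵥ x + vecT b))`;
* `outMap_eq_outMap` — by uniqueness of the normal form, the normalised transform depends only on the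
  presented function `F₂ˢ → F₂^m`;
* `liftT` (typed lift of an untyped presentation), `affOut_affOut` / `mulVec_affine` (the affine
  action composes), `rowsOf`, `matT_rowsOf`, `vecT_ofFn` (matrices and vectors to lists and back).

References: J. Patarin, EUROCRYPT 1996, §2; Dvir–Gutfreund–Rothblum–Vadhan, ICS 2011, §2.
-/

namespace Summit.PneNP.PneNP.Cruxes.PeaWorstToAvg.OrbitPairRsr

set_option linter.dupNamespace false -- Summit.PneNP.PneNP: summit = sub-problem (D-0017)

open Literature.Computability.Complexity RandPoly

namespace OKit

/-! ### The typed bridge: the transform presents `(B·+c) ∘ P ∘ (A·+b)` -/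

/-- Coordinates of the value of a typed map, through the untyped presentation. [folklore] -/
theorem getD_eval {s : ℕ} (P : PolyMapF2 s) (y : Fin s → ZMod 2) (i : ℕ) :
    (P.eval y).getD i 0 = evalP (ext y) ((P.map (List.map (List.map Fin.val))).getD i []) := by
  rw [← evalM_untyped P y]
  change (List.map (evalP (ext y)) _).getD i (evalP (ext y) []) = _
  rw [List.getD_map]

/-- Monomials of the untyped presentation of a `DegLE 3` map have length `≤ 3`. [folklore] -/
theorem untyped_degLE {s : ℕ} {P : PolyMapF2 s} (hP : P.DegLE 3) :
    ∀ q ∈ P.map (List.map (List.map Fin.val)), ∀ μ ∈ q, μ.length ≤ 3 := by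
  intro q hq μ hμ
  obtain ⟨p, hp, rfl⟩ := List.mem_map.1 hq
  obtain ⟨ν, hν, rfl⟩ := List.mem_map.1 hμ
  simpa using hP p hp ν hν

/-- Indices of the untyped presentation are `< s`. [folklore] -/
theorem untyped_lt {s : ℕ} (P : PolyMapF2 s) :
    ∀ q ∈ P.map (List.map (List.map Fin.val)), ∀ μ ∈ q, ∀ i ∈ μ, i < s := by
  intro q hq μ hμ i hi
  obtain ⟨p, -, rfl⟩ := List.mem_map.1 hq
  obtain ⟨ν, -, rfl⟩ := List.mem_map.1 hμ
  obtain ⟨j, -, rfl⟩ := List.mem_map.1 hi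
  exact j.isLt

/-- Items of the untyped presentation, with the default `[]`. [folklore] -/
theorem getD_untyped_mem_or {s : ℕ} (P : PolyMapF2 s) (i : ℕ) :
    (P.map (List.map (List.map Fin.val))).getD i [] ∈ P.map (List.map (List.map Fin.val)) ∨
      (P.map (List.map (List.map Fin.val))).getD i [] = [] := by
  rw [List.getD_eq_getElem?_getD]
  cases h : (P.map (List.map (List.map Fin.val)))[i]? with
  | none => exact Or.inr rfl
  | some q => exact Or.inl (by simpa using List.mem_of_getElem? h)

/-- A `Finset.range` sum of a function vanishing from `s` on is a sum over `Fin s`. [folklore] -/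
theorem sum_range_ext {s : ℕ} (f : ℕ → ZMod 2) (x : Fin s → ZMod 2) :
    (∑ l ∈ Finset.range s, f l * ext x l) = ∑ j : Fin s, f j * x j := by
  rw [← Fin.sum_univ_eq_sum_range]
  simp

/-- **The transform presents the affine action**: for a cubic `P : PolyMapF2 s`, the value of
`transform s P̃ A b B c` (`P̃` the untyped presentation) at `ext x` is
`affOut (matT B) (vecT c) (P.eval (matT A *ᵥ x + vecT b))`. [cite: Patarin1996, §2] -/
theorem evalM_transform {s : ℕ} (P : PolyMapF2 s) (hP : P.DegLE 3) (A : List (List (ZMod 2)))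
    (b : List (ZMod 2)) (B : List (List (ZMod 2))) (c : List (ZMod 2)) (x : Fin s → ZMod 2) :
    evalM (ext x) (transform s (P.map (List.map (List.map Fin.val))) A b B c) =
      affOut (matT P.length B) (vecT P.length c) (P.eval ((matT s A).mulVec x + vecT s b)) := by
  set P' := P.map (List.map (List.map Fin.val)) with hP'
  set y := (matT s A).mulVec x + vecT s b with hy
  have hlen : P'.length = P.length := by simp [hP']
  -- the values of the affine forms are the coordinates of `y`
  have hw : ∀ i < s, evalP (ext x) (affForm s A b i) = ext y i := by
    intro i hi
    rw [evalP_affForm, ext_apply_lt _ hi, hy, Pi.add_apply, sum_range_ext]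
    simp [matT, vecT, Matrix.mulVec, dotProduct]
  -- hence substituted coordinates of `P` take the values of `P` at `y`
  have hcoord : ∀ i, evalP (ext x) (substP s A b (P'.getD i [])) = (P.eval y).getD i 0 := by
    intro i
    have hdeg : ∀ μ ∈ P'.getD i [], μ.length ≤ 3 := by
      rcases getD_untyped_mem_or P i with h | h
      · exact untyped_degLE hP _ h
      · rw [h]; simp
    have hlt : ∀ μ ∈ P'.getD i [], ∀ l ∈ μ, l < s := by
      rcases getD_untyped_mem_or P i with h | h
      · exact untyped_lt P _ h
      · rw [h]; simp
    rw [evalP_substP _ _ _ _ hdeg, getD_eval]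
    exact evalP_congr fun μ hμ l hl => hw l (hlt μ hμ l hl)
  refine List.ext_getElem (by simp [transform, affOut, hlen]) fun i h₁ h₂ => ?_
  have hi : i < P.length := by simpa [affOut] using h₂
  simp only [evalM, transform, List.map_map, List.getElem_map, List.getElem_range, Function.comp_apply,
    affOut, List.getElem_ofFn, Pi.add_apply]
  have hQ : ∀ j, (P'.map (substP s A b)).getD j [] = substP s A b (P'.getD j []) := fun j => by
    change (P'.map (substP s A b)).getD j (substP s A b []) = _
    rw [List.getD_map]
  rw [evalP_mixP, List.length_map, hlen]
  simp_rw [hQ, hcoord]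
  rw [← Fin.sum_univ_eq_sum_range (fun j => ent B i j * (P.eval y).getD j 0)]
  simp [matT, vecT, Matrix.mulVec, dotProduct]

/-- Values at arbitrary valuations are values at points of `F₂ˢ`, for maps with indices `< s`. [folklore] -/
theorem evalM_eq_evalM_ext {s : ℕ} {Q : List (List (List ℕ))} (hQ : ∀ q ∈ Q, ∀ μ ∈ q, ∀ i ∈ μ, i < s)
    (v : ℕ → ZMod 2) : evalM v Q = evalM (ext fun j : Fin s => v j) Q :=
  evalM_congr fun q hq μ hμ i hi => by rw [ext_apply_lt _ (hQ q hq μ hμ i hi)]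

/-- **Canonicity on `F₂ˢ`**: canonical forms of maps with the same number of coordinates and the same
values at all points of `F₂ˢ` are equal. [folklore] -/
theorem canonM_eq_of_forall_ext {s : ℕ} {Q₁ Q₂ : List (List (List ℕ))} (hlen : Q₁.length = Q₂.length)
    (h : ∀ x : Fin s → ZMod 2, evalM (ext x) (canonM s Q₁) = evalM (ext x) (canonM s Q₂)) :
    canonM s Q₁ = canonM s Q₂ :=
  canonM_eq_of_evalM_eq hlen fun v => by
    rw [evalM_eq_evalM_ext (fun q hq μ hμ => (canonM_wf hq hμ).1) v,
      evalM_eq_evalM_ext (Q := canonM s Q₂) (fun q hq μ hμ => (canonM_wf hq hμ).1) v, h]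

/-- **The normalised transform presents the affine action.** [cite: Patarin1996, §2] -/
theorem evalM_outMap {s : ℕ} (P : PolyMapF2 s) (hP : P.DegLE 3) (A : List (List (ZMod 2)))
    (b : List (ZMod 2)) (B : List (List (ZMod 2))) (c : List (ZMod 2)) (x : Fin s → ZMod 2) :
    evalM (ext x) (outMap s (P.map (List.map (List.map Fin.val))) A b B c) =
      affOut (matT P.length B) (vecT P.length c) (P.eval ((matT s A).mulVec x + vecT s b)) := by
  rw [outMap, evalM_canonM, evalM_transform P hP]
  exact fun q hq ν hν => ⟨(transform_wf hq hν).1, (List.toFinset_card_le ν).trans (transform_wf hq hν).2⟩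

/-- **The normalised transform depends only on the presented function**: two cubic maps and two
tuples `(A, b, B, c)` presenting the same function `F₂ˢ → F₂^m` have the same normalised transform.
[folklore] -/
theorem outMap_eq_outMap {s : ℕ} {P Q : PolyMapF2 s} (hP : P.DegLE 3) (hQ : Q.DegLE 3)
    (hlen : P.length = Q.length) {A A' B B' : List (List (ZMod 2))} {b b' c c' : List (ZMod 2)}
    (h : ∀ x : Fin s → ZMod 2,
      affOut (matT P.length B) (vecT P.length c) (P.eval ((matT s A).mulVec x + vecT s b)) =
        affOut (matT Q.length B') (vecT Q.length c') (Q.eval ((matT s A').mulVec x + vecT s b'))) :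
    outMap s (P.map (List.map (List.map Fin.val))) A b B c =
      outMap s (Q.map (List.map (List.map Fin.val))) A' b' B' c' :=
  canonM_eq_of_forall_ext (by simpa using hlen) fun x => by
    have h1 := evalM_outMap P hP A b B c x
    have h2 := evalM_outMap Q hQ A' b' B' c' x
    rw [outMap] at h1 h2
    rw [h1, h2, h x]

/-! ### Typed lift of an untyped presentation -/

/-- The typed map with the given untyped presentation (indices reduced mod `s`; exact when all indices
are `< s`). [folklore] -/
def liftT (s : ℕ) (hs : 0 < s) (Q : List (List (List ℕ))) : PolyMapF2 s :=
  Q.map (List.map (List.map fun i => (⟨i % s, Nat.mod_lt i hs⟩ : Fin s)))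

/-- The lift has the same number of coordinates. [folklore] -/
@[simp] theorem length_liftT (s : ℕ) (hs : 0 < s) (Q : List (List (List ℕ))) : (liftT s hs Q).length = Q.length :=
  List.length_map _

/-- The untyped presentation of the lift is the original presentation. [folklore] -/
theorem untyped_liftT {s : ℕ} (hs : 0 < s) {Q : List (List (List ℕ))}
    (hQ : ∀ q ∈ Q, ∀ μ ∈ q, ∀ i ∈ μ, i < s) : (liftT s hs Q).map (List.map (List.map Fin.val)) = Q := by
  rw [liftT, List.map_map]
  conv_rhs => rw [← List.map_id Q]
  refine List.map_congr_left fun q hq => ?_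
  rw [Function.comp_apply, List.map_map, id]
  conv_rhs => rw [← List.map_id q]
  refine List.map_congr_left fun μ hμ => ?_
  rw [Function.comp_apply, List.map_map, id]
  conv_rhs => rw [← List.map_id μ]
  refine List.map_congr_left fun i hi => ?_
  simp [Nat.mod_eq_of_lt (hQ q hq μ hμ i hi)]

/-- The lift of a presentation with monomials of length `≤ 3` is cubic. [folklore] -/
theorem degLE_liftT {s : ℕ} (hs : 0 < s) {Q : List (List (List ℕ))} (hQ : ∀ q ∈ Q, ∀ μ ∈ q, μ.length ≤ 3) :
    (liftT s hs Q).DegLE 3 := by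
  intro p hp μ hμ
  obtain ⟨q, hq, rfl⟩ := List.mem_map.1 hp
  obtain ⟨ν, hν, rfl⟩ := List.mem_map.1 hμ
  simpa using hQ q hq ν hν

/-- The lift evaluates as the presentation. [folklore] -/
theorem eval_liftT {s : ℕ} (hs : 0 < s) {Q : List (List (List ℕ))} (hQ : ∀ q ∈ Q, ∀ μ ∈ q, ∀ i ∈ μ, i < s)
    (x : Fin s → ZMod 2) : (liftT s hs Q).eval x = evalM (ext x) Q := by
  rw [← evalM_untyped, untyped_liftT hs hQ]

/-! ### The affine action composes -/

/-- Reading back a written word. [folklore] -/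
theorem getD_ofFn {m : ℕ} (g : Fin m → ZMod 2) (i : Fin m) : (List.ofFn g).getD i 0 = g i := by
  rw [List.getD_eq_getElem _ _ (by simp), List.getElem_ofFn]

/-- **Composition of output relabellings**: `(B·+c) ∘ (B₀·+c₀) = (B B₀ · + (B c₀ + c))`.
[cite: Patarin1996, §2] -/
theorem affOut_affOut {m : ℕ} (B B₀ : Matrix (Fin m) (Fin m) (ZMod 2)) (c c₀ : Fin m → ZMod 2)
    (l : List (ZMod 2)) : affOut B c (affOut B₀ c₀ l) = affOut (B * B₀) (B.mulVec c₀ + c) l := by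
  unfold affOut
  have : (fun i : Fin m => (List.ofFn (B₀.mulVec (fun i : Fin m => l.getD i 0) + c₀)).getD i 0) =
      B₀.mulVec (fun i : Fin m => l.getD i 0) + c₀ := funext fun i => getD_ofFn _ i
  rw [this, Matrix.mulVec_add, Matrix.mulVec_mulVec, add_assoc]

/-- **Composition of input changes**: `A₀ (A x + b) + b₀ = (A₀ A) x + (A₀ b + b₀)`. [cite: Patarin1996, §2] -/
theorem mulVec_affine {s : ℕ} (A₀ A : Matrix (Fin s) (Fin s) (ZMod 2)) (b b₀ x : Fin s → ZMod 2) :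
    A₀.mulVec (A.mulVec x + b) + b₀ = (A₀ * A).mulVec x + (A₀.mulVec b + b₀) := by
  rw [Matrix.mulVec_add, Matrix.mulVec_mulVec, add_assoc]

/-- Transport of the read-off relabelling along an equality of dimensions. [folklore] -/
theorem affOut_matT_cast {m m' : ℕ} (h : m = m') (B : List (List (ZMod 2))) (c : List (ZMod 2))
    (l : List (ZMod 2)) : affOut (matT m B) (vecT m c) l = affOut (matT m' B) (vecT m' c) l := by
  subst h; rfl

/-- The rows of a matrix, as lists. [folklore] -/
def rowsOf {s : ℕ} (M : Matrix (Fin s) (Fin s) (ZMod 2)) : List (List (ZMod 2)) :=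
  List.ofFn fun i => List.ofFn fun j => M i j

/-- Reading back the rows of a matrix. [folklore] -/
@[simp] theorem matT_rowsOf {s : ℕ} (M : Matrix (Fin s) (Fin s) (ZMod 2)) : matT s (rowsOf M) = M := by
  ext i j
  simp only [matT, Matrix.of_apply, ent, rowsOf]
  have h1 : (List.ofFn fun i => List.ofFn fun j => M i j).getD i [] = List.ofFn (M i) := by
    rw [List.getD_eq_getElem _ _ (by simp), List.getElem_ofFn]
  rw [h1, getD_ofFn]

/-- Reading back the entries of a vector. [folklore] -/
@[simp] theorem vecT_ofFn {s : ℕ} (b : Fin s → ZMod 2) : vecT s (List.ofFn b) = b :=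
  funext fun i => getD_ofFn b i

end OKit

/-- **The normalised transform presents the affine action (anchor of the helper file).**
[cite: Patarin1996, §2] -/
theorem orbitKit_evalM_outMap {s : ℕ} (P : PolyMapF2 s) (hP : P.DegLE 3) (A : List (List (ZMod 2)))
    (b : List (ZMod 2)) (B : List (List (ZMod 2))) (c : List (ZMod 2)) (x : Fin s → ZMod 2) :
    evalM (OKit.ext x) (OKit.outMap s (P.map (List.map (List.map Fin.val))) A b B c) =
      affOut (OKit.matT P.length B) (OKit.vecT P.length c) (P.eval ((OKit.matT s A).mulVec x + OKit.vecT s b)) :=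
  OKit.evalM_outMap P hP A b B c x

end Summit.PneNP.PneNP.Cruxes.PeaWorstToAvg.OrbitPairRsr
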